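import Literature.NumberTheory.GaloisRepresentations.DiscreteCochains
import HarnessLib

/-!
# Averaging: `H¹ = H² = 0` for a finite group when the identity is a trace (Serre, *Corps locaux* VIII)

Let a finite (discrete) group `G` act on a discrete module `A`, and suppose there is an additive
map `λ : A → A` with `Σ_{m ∈ G} m λ(m⁻¹ a) = a` for all `a` — e.g. `A = E` the additive group
of a finite Galois extension `E/F` with group `G` and `λ = (θ · )` for an element `θ` of trace
`1` (Serre, *Cohomologie galoisienne*, II §1.1 Prop. 1: "`H^q(G(K/k), K) = 0` pour tout
`q ≥ 1`. En effet … `K` est isomorphe à … module induit"; *Corps locaux*, VIII §1 and X §1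
Prop. 1).  Then every homogeneous `q`-cocycle `c` is a coboundary: with
`(h c)(x₀, …, x_{q-1}) = Σ_m m λ(m⁻¹ c(x₀, …, x_{q-1}, m))` the cocycle identity in the last
variable gives `d(h c) = (-1)^q c` (the classical argument that `Cor ∘ Res` through the trivial
subgroup kills cohomology, with the twist `λ`).  This file carries it out in degrees `1` and `2`
for Mathlib's model `continuousCohomology` (nested continuous maps `C(G, C(G, ⋯ C(G, A)))`,
differential `(d F)(g) = F - d(F g)`):

* `subsingleton_continuousCohomology_one_of_avg_eq`,
  `subsingleton_continuousCohomology_two_of_avg_eq`.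

These give the vanishing of `H¹` and `H²` of the finite layers `Gal(E/F)` acting on `E⁺` used in
the Artin–Schreier part (characteristic `p`, Serre II §2.2 Prop. 3) of the proof of Serre II
§3.1 Prop. 5 for `Literature.NumberTheory.GaloisRepresentations.tsen_fieldCdLE_one_of_trdeg_eq_one`.

## References

* J.-P. Serre, *Cohomologie galoisienne*, 5e éd., LNM 5 (1994) / *Galois Cohomology* (1997),
  II §1.1 Prop. 1, I §2.2 (cochains). [SerreGaloisCohomology1997]
* J.-P. Serre, *Corps locaux* / *Local Fields*, GTM 67 (1979), VIII §1, X §1 Prop. 1.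
  [SerreLocalFields1979]
-/

noncomputable section

open CategoryTheory Topology

universe u

namespace Literature.NumberTheory.GaloisRepresentations

open _root_.TopRep _root_.ContRepresentation _root_.ContinuousCohomology

set_option allowUnsafeReducibility true in
attribute [local reducible] CategoryTheory.Functor.mapHomologicalComplex

/-! ### Explicit formulas for the first differentials of the standard resolution -/

section Differentials

variable {k : Type*} [Ring k] [TopologicalSpace k]
variable {G : Type u} [Group G] [TopologicalSpace G] [IsTopologicalGroup G]
variable (X : TopRep.{u} k G)

/-- `(d₁ φ)(g)(h) = φ h - φ g`. [folklore] -/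
theorem d_one_apply (φ : resolutionX X 1) (g h : G) :
    (d X 1).hom φ g h = (φ : C(G, X)) h - (φ : C(G, X)) g := by
  rw [d_succ_hom_apply, ContinuousMap.sub_apply, d_zero_hom_apply]

/-- `(d₂ F)(g)(h)(l) = F h l - F g l + F g h`. [folklore] -/
theorem d_two_apply (F : resolutionX X 2) (g h l : G) :
    (d X 2).hom F g h l =
      (F : C(G, C(G, X))) h l - (F : C(G, C(G, X))) g l + (F : C(G, C(G, X))) g h := by
  rw [d_succ_hom_apply, ContinuousMap.sub_apply, ContinuousMap.sub_apply, d_one_apply]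
  abel

/-- `(d₃ c)(g)(h)(l)(m) = c h l m - c g l m + c g h m - c g h l`. [folklore] -/
theorem d_three_apply (c : resolutionX X 3) (g h l m : G) :
    (d X 3).hom c g h l m =
      (c : C(G, C(G, C(G, X)))) h l m - (c : C(G, C(G, C(G, X)))) g l m +
        (c : C(G, C(G, C(G, X)))) g h m - (c : C(G, C(G, C(G, X)))) g h l := by
  rw [d_succ_hom_apply, ContinuousMap.sub_apply, ContinuousMap.sub_apply, ContinuousMap.sub_apply,
    d_two_apply]
  abel

/-- Invariance of a homogeneous `1`-cochain: `g (f (g⁻¹ x) (g⁻¹ y)) = f x y`. [folklore] -/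
theorem apply_of_mem_invariants_two (f : (resolutionX X 2).ρ.invariants) (g x y : G) :
    X.ρ g ((f.1 : C(G, C(G, X))) (g⁻¹ * x) (g⁻¹ * y)) = (f.1 : C(G, C(G, X))) x y := by
  have h := congr($((mem_invariants _).1 f.2 g) x y)
  rw [resolutionX_succ_ρ_apply, resolutionX_succ_ρ_apply] at h
  exact h

/-- Invariance of a homogeneous `2`-cochain: `g (c (g⁻¹ x) (g⁻¹ y) (g⁻¹ z)) = c x y z`.
[folklore] -/
theorem apply_of_mem_invariants_three (c : (resolutionX X 3).ρ.invariants) (g x y z : G) :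
    X.ρ g ((c.1 : C(G, C(G, C(G, X)))) (g⁻¹ * x) (g⁻¹ * y) (g⁻¹ * z)) =
      (c.1 : C(G, C(G, C(G, X)))) x y z := by
  have h := congr($((mem_invariants _).1 c.2 g) x y z)
  rw [resolutionX_succ_ρ_apply, resolutionX_succ_ρ_apply, resolutionX_succ_ρ_apply] at h
  exact h

end Differentials

/-! ### The averaging operator -/

section Averaging

variable {k : Type*} [CommRing k] [TopologicalSpace k]
variable {G : Type u} [Group G] [TopologicalSpace G] [Fintype G]
variable {A : Type u} [AddCommGroup A] [Module k A] [TopologicalSpace A] [DiscreteTopology A]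
  [ContinuousSMul k A]
variable (ρ : ContinuousRep G k A) (lam : A →+ A)

/-- The **averaging operator** on functions `φ : G → A`: `Σ_m m λ(m⁻¹ φ(m))`.
[cite: SerreLocalFields1979, VIII §1] -/
def avgFun (φ : G → A) : A := ∑ m : G, ρ m (lam (ρ m⁻¹ (φ m)))

omit [DiscreteTopology A] [ContinuousSMul k A] in
/-- `avgFun` is additive in `φ`. [folklore] -/
theorem avgFun_add (φ ψ : G → A) : avgFun ρ lam (φ + ψ) = avgFun ρ lam φ + avgFun ρ lam ψ := by
  unfold avgFun
  rw [← Finset.sum_add_distrib]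
  exact Finset.sum_congr rfl fun m _ => by rw [Pi.add_apply, map_add, map_add, map_add]

omit [DiscreteTopology A] [ContinuousSMul k A] in
/-- `avgFun` commutes with subtraction. [folklore] -/
theorem avgFun_sub (φ ψ : G → A) : avgFun ρ lam (φ - ψ) = avgFun ρ lam φ - avgFun ρ lam ψ := by
  unfold avgFun
  rw [← Finset.sum_sub_distrib]
  exact Finset.sum_congr rfl fun m _ => by rw [Pi.sub_apply, map_sub, map_sub, map_sub]
omit [DiscreteTopology A] [ContinuousSMul k A] in
/-- `avgFun` of `-φ`. [folklore] -/
theorem avgFun_neg (φ : G → A) : avgFun ρ lam (-φ) = -avgFun ρ lam φ := by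
  unfold avgFun
  rw [← Finset.sum_neg_distrib]
  exact Finset.sum_congr rfl fun m _ => by rw [Pi.neg_apply, map_neg, map_neg, map_neg]

omit [DiscreteTopology A] [ContinuousSMul k A] in
/-- **Equivariance of averaging**: `g · avgFun (m ↦ g⁻¹ φ(g m)) = avgFun φ` (reindex `m ↦ g m`).
[folklore] -/
theorem apply_avgFun_eq (g : G) (φ : G → A) :
    ρ g (avgFun ρ lam fun m => ρ g⁻¹ (φ (g * m))) = avgFun ρ lam φ := by
  unfold avgFun
  rw [map_sum]
  refine Fintype.sum_equiv (Equiv.mulLeft g) _ _ fun m => ?_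
  rw [Equiv.coe_mulLeft, ← Module.End.mul_apply, ← map_mul, ← Module.End.mul_apply (ρ m⁻¹),
    ← map_mul, ← mul_inv_rev]

end Averaging

/-! ### Vanishing of `H¹` and `H²` -/

section Vanishing

variable {k : Type*} [CommRing k] [TopologicalSpace k]
variable {G : Type u} [Group G] [TopologicalSpace G] [DiscreteTopology G] [IsTopologicalGroup G]
  [Fintype G]
variable {A : Type u} [AddCommGroup A] [Module k A] [TopologicalSpace A] [DiscreteTopology A]
  [ContinuousSMul k A]
variable (ρ : ContinuousRep G k A) (lam : A →+ A) (hlam : ∀ a : A, avgFun ρ lam (fun _ => a) = a)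

include hlam

/-- **`H¹(G, A) = 0` by averaging** (finite discrete `G`, discrete `A`, `λ` with
`Σ_m m λ(m⁻¹ a) = a`): the homogeneous `1`-cocycle `f` is `d` of the `0`-cochain
`x ↦ - Σ_m m λ(m⁻¹ f(x, m))`. [cite: SerreGaloisCohomology1997, II §1.1 Prop. 1]
[cite: SerreLocalFields1979, X §1 Prop. 1] -/
theorem subsingleton_continuousCohomology_one_of_avg_eq :
    Subsingleton (continuousCohomology 1 ρ.toTopRep) := by
  have h0 : Subsingleton ((homogeneousCochains ρ.toTopRep).homology (0 + 1)) := by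
    rw [subsingleton_homology_succ_iff]
    intro σ hσ
    have hσ : (homogeneousCochains ρ.toTopRep).d 1 2 σ = 0 := hσ
    show ∃ y : (homogeneousCochains ρ.toTopRep).X 0, (homogeneousCochains ρ.toTopRep).d 0 1 y = σ
    -- the cocycle identity `f h l - f g l + f g h = 0`
    have hcoc : ∀ g h l : G, (σ.1 : C(G, C(G, A))) h l - (σ.1 : C(G, C(G, A))) g l +
        (σ.1 : C(G, C(G, A))) g h = 0 := fun g h l => by
      have := congr(((($hσ : (homogeneousCochains ρ.toTopRep).X 2) : resolutionX ρ.toTopRep 3) :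
        C(G, C(G, C(G, A)))) g h l)
      rw [cochains_d_coe, d_two_apply] at this
      exact this
    -- the averaged `0`-cochain
    let τ : C(G, A) := ⟨fun x => -avgFun ρ lam fun m => (σ.1 : C(G, C(G, A))) x m,
      continuous_of_discreteTopology⟩
    have hτ : τ ∈ (resolutionX ρ.toTopRep 1).ρ.invariants := by
      refine (mem_invariants _).2 fun g => ContinuousMap.ext fun x => ?_
      rw [resolutionX_succ_ρ_apply]
      change ρ g (-avgFun ρ lam fun m => (σ.1 : C(G, C(G, A))) (g⁻¹ * x) m) =
        -avgFun ρ lam fun m => (σ.1 : C(G, C(G, A))) x m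
      rw [map_neg, ← apply_avgFun_eq ρ lam g fun m => (σ.1 : C(G, C(G, A))) x m]
      congr 3
      funext m
      rw [← apply_of_mem_invariants_two ρ.toTopRep σ g x (g * m), inv_mul_cancel_left]
      change _ = ρ g⁻¹ (ρ g ((σ.1 : C(G, C(G, A))) (g⁻¹ * x) m))
      rw [← Module.End.mul_apply, ← map_mul, inv_mul_cancel, map_one, Module.End.one_apply]
    refine ⟨⟨τ, hτ⟩, Subtype.ext (ContinuousMap.ext fun x => ContinuousMap.ext fun h => ?_)⟩
    rw [cochains_d_coe, d_one_apply]
    change (-avgFun ρ lam fun m => (σ.1 : C(G, C(G, A))) h m) -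
        -avgFun ρ lam (fun m => (σ.1 : C(G, C(G, A))) x m) = (σ.1 : C(G, C(G, A))) x h
    rw [neg_sub_neg, ← avgFun_sub]
    have : ((fun m => (σ.1 : C(G, C(G, A))) x m) - fun m => (σ.1 : C(G, C(G, A))) h m) =
        fun _ => (σ.1 : C(G, C(G, A))) x h := by
      funext m
      rw [Pi.sub_apply, ← sub_eq_zero, ← neg_eq_zero, ← hcoc x h m]
      abel
    rw [this, hlam]
  exact h0

/-- **`H²(G, A) = 0` by averaging** (finite discrete `G`, discrete `A`, `λ` with
`Σ_m m λ(m⁻¹ a) = a`): the homogeneous `2`-cocycle `c` is `d` of the `1`-cochain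
`(x, y) ↦ Σ_m m λ(m⁻¹ c(x, y, m))`. [cite: SerreGaloisCohomology1997, II §1.1 Prop. 1]
[cite: SerreLocalFields1979, X §1 Prop. 1] -/
theorem subsingleton_continuousCohomology_two_of_avg_eq :
    Subsingleton (continuousCohomology 2 ρ.toTopRep) := by
  have h0 : Subsingleton ((homogeneousCochains ρ.toTopRep).homology (1 + 1)) := by
    rw [subsingleton_homology_succ_iff]
    intro σ hσ
    have hσ : (homogeneousCochains ρ.toTopRep).d 2 3 σ = 0 := hσ
    show ∃ y : (homogeneousCochains ρ.toTopRep).X 1, (homogeneousCochains ρ.toTopRep).d 1 2 y = σ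
    -- the cocycle identity `c h l m - c g l m + c g h m - c g h l = 0`
    have hcoc : ∀ g h l m : G, (σ.1 : C(G, C(G, C(G, A)))) h l m -
        (σ.1 : C(G, C(G, C(G, A)))) g l m + (σ.1 : C(G, C(G, C(G, A)))) g h m -
        (σ.1 : C(G, C(G, C(G, A)))) g h l = 0 := fun g h l m => by
      have := congr(((($hσ : (homogeneousCochains ρ.toTopRep).X 3) :
        resolutionX ρ.toTopRep 4) : C(G, C(G, C(G, C(G, A))))) g h l m)
      rw [cochains_d_coe, d_three_apply] at this
      exact this
    -- the averaged `1`-cochain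
    let τ : C(G, C(G, A)) := ⟨fun x => ⟨fun y => avgFun ρ lam fun m =>
      (σ.1 : C(G, C(G, C(G, A)))) x y m, continuous_of_discreteTopology⟩,
      continuous_of_discreteTopology⟩
    have hτ : τ ∈ (resolutionX ρ.toTopRep 2).ρ.invariants := by
      refine (mem_invariants _).2 fun g => ContinuousMap.ext fun x => ContinuousMap.ext fun y => ?_
      rw [resolutionX_succ_ρ_apply, resolutionX_succ_ρ_apply]
      change ρ g (avgFun ρ lam fun m => (σ.1 : C(G, C(G, C(G, A)))) (g⁻¹ * x) (g⁻¹ * y) m) =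
        avgFun ρ lam fun m => (σ.1 : C(G, C(G, C(G, A)))) x y m
      rw [← apply_avgFun_eq ρ lam g fun m => (σ.1 : C(G, C(G, C(G, A)))) x y m]
      congr 2
      funext m
      rw [← apply_of_mem_invariants_three ρ.toTopRep σ g x y (g * m), inv_mul_cancel_left]
      change _ = ρ g⁻¹ (ρ g ((σ.1 : C(G, C(G, C(G, A)))) (g⁻¹ * x) (g⁻¹ * y) m))
      rw [← Module.End.mul_apply, ← map_mul, inv_mul_cancel, map_one, Module.End.one_apply]
    refine ⟨⟨τ, hτ⟩, Subtype.ext (ContinuousMap.ext fun g => ContinuousMap.ext fun h =>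
      ContinuousMap.ext fun l => ?_)⟩
    rw [cochains_d_coe, d_two_apply]
    change (avgFun ρ lam fun m => (σ.1 : C(G, C(G, C(G, A)))) h l m) -
        (avgFun ρ lam fun m => (σ.1 : C(G, C(G, C(G, A)))) g l m) +
        (avgFun ρ lam fun m => (σ.1 : C(G, C(G, C(G, A)))) g h m) =
      (σ.1 : C(G, C(G, C(G, A)))) g h l
    rw [← avgFun_sub, ← avgFun_add]
    have : ((fun m => (σ.1 : C(G, C(G, C(G, A)))) h l m) -
        (fun m => (σ.1 : C(G, C(G, C(G, A)))) g l m) +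
        fun m => (σ.1 : C(G, C(G, C(G, A)))) g h m) =
        fun _ => (σ.1 : C(G, C(G, C(G, A)))) g h l := by
      funext m
      rw [Pi.add_apply, Pi.sub_apply, ← sub_eq_zero]
      exact hcoc g h l m
    rw [this, hlam]
  exact h0

end Vanishing

end Literature.NumberTheory.GaloisRepresentations

end
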